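import Summits.KontsevichZagierPeriods.Zeta5Search.LaiSweepShard

/-!
# `κ₃` sweep certificate — shard file 081 of 127 (shards 567–573 of 889)

HONEST FRAMING. Systematic search; no irrationality claim unless certified. This file only checks,
by `decide +kernel`, shards 567–573 of the order-cell sweep of the `κ₃` point `(74, 2180, 444; δ74)`
(engine `LaiSweepEngine`, soundness `LaiSweepJump/Free/Eval/Shard/Kappa3`; a shard is `⟨regime, n,
p, q, p', q', Lo, Up⟩`: `n` cells from `p/q` to `p'/q'` with integer rate sums in `[Lo, Up]`, `K =
128`, `D = 2^40`). It draws NO conclusion: only the capstone `LaiKappa3SweepCert`, which needs all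
127 shard files, does. Kernel cost of this file ≈ 560 cells × 0.3 s.
-/

namespace Summit.KontsevichZagierPeriods.Zeta5Search.Sweep

set_option maxHeartbeats 100000000 in
/-- Shard 567: 80 cells of regime B from `228/383` to `173/290`.
[cite: Lai2024BallRivoal, §4 Lemma 4.3] -/
theorem shard567 :
    Shard.check 128 (2^40)
      ⟨true, 80, 228, 383, 173, 290, 13269066835241, 17415371009596⟩ = true := by
  decide +kernel

set_option maxHeartbeats 100000000 in
/-- Shard 568: 80 cells of regime B from `173/290` to `107/179`.
[cite: Lai2024BallRivoal, §4 Lemma 4.3] -/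
theorem shard568 :
    Shard.check 128 (2^40)
      ⟨true, 80, 173, 290, 107, 179, 12845189659089, 16875760228877⟩ = true := by
  decide +kernel

set_option maxHeartbeats 100000000 in
/-- Shard 569: 80 cells of regime B from `107/179` to `118/197`.
[cite: Lai2024BallRivoal, §4 Lemma 4.3] -/
theorem shard569 :
    Shard.check 128 (2^40)
      ⟨true, 80, 107, 179, 118, 197, 12894013512734, 16956517364645⟩ = true := by
  decide +kernel

set_option maxHeartbeats 100000000 in
/-- Shard 570: 80 cells of regime B from `118/197` to `212/353`.
[cite: Lai2024BallRivoal, §4 Lemma 4.3] -/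
theorem shard570 :
    Shard.check 128 (2^40)
      ⟨true, 80, 118, 197, 212, 353, 16680407325421, 21962463637696⟩ = true := by
  decide +kernel

set_option maxHeartbeats 100000000 in
/-- Shard 571: 80 cells of regime B from `212/353` to `74/123`.
[cite: Lai2024BallRivoal, §4 Lemma 4.3] -/
theorem shard571 :
    Shard.check 128 (2^40)
      ⟨true, 80, 212, 353, 74, 123, 11164757239135, 14714693586320⟩ = true := by
  decide +kernel

set_option maxHeartbeats 100000000 in
/-- Shard 572: 80 cells of regime B from `74/123` to `211/350`.
[cite: Lai2024BallRivoal, §4 Lemma 4.3] -/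
theorem shard572 :
    Shard.check 128 (2^40)
      ⟨true, 80, 74, 123, 211, 350, 12964020899003, 17101946035079⟩ = true := by
  decide +kernel

set_option maxHeartbeats 100000000 in
/-- Shard 573: 80 cells of regime B from `211/350` to `177/293`.
[cite: Lai2024BallRivoal, §4 Lemma 4.3] -/
theorem shard573 :
    Shard.check 128 (2^40)
      ⟨true, 80, 211, 350, 177, 293, 13025789197263, 17200634498659⟩ = true := by
  decide +kernel

/-- The checked shards of this file, in order. [folklore] -/
def shards081 : List (CheckedShard 128 (2^40)) :=
  [⟨_, shard567⟩, ⟨_, shard568⟩, ⟨_, shard569⟩, ⟨_, shard570⟩, ⟨_, shard571⟩,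
    ⟨_, shard572⟩, ⟨_, shard573⟩]

end Summit.KontsevichZagierPeriods.Zeta5Search.Sweep
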